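import Literature.Analysis.InverseSpectral.KreinStringOperations
import Literature.Analysis.InverseSpectral.KreinStringShift
import HarnessLib

/-!
# Stieltjes strings: construction and their Titchmarsh–Weyl functions

The two elementary constructions on Kreĭn strings,

* `KreinString.addDirac S m₀` — add a point mass `m₀ ≥ 0` at the left end (`dm + m₀ δ₀`),
* `KreinString.prepend S a` — prepend a massless segment of length `a ≥ 0`
  (`L + a`, `dm ∘ (· - a)`),

the free half-line `KreinString.freeHalfLine = S[0, ∞]` and the empty string of finite length
`KreinString.empty L = S[0, L]`, and the resulting **Stieltjes strings** (finitely many point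
masses):
iterating the constructions realises every finite Stieltjes continued fraction

  `q(z) = l₀ + 1/(-m₁ z + 1/(l₁ + 1/(-m₂ z + … )))`

as the principal Titchmarsh–Weyl function of a string (`exists_string_stieltjesCF`,
`exists_string_stieltjesCF_infinite`), by `principalWeylFunction_add_dirac` and
`principalWeylFunction_shift` (Kac–Kreĭn 1974 §2; Gantmacher–Kreĭn, Supplement II). This is the
direct half of Kreĭn's theorem for rational Stieltjes functions, the first step of the existence
part (iii) of `KreinInverseSpectralTheorem`.

## References

KacKrein1974 (§§1–2), DymMcKean1976 (§5.8).
-/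

open MeasureTheory Filter Set Topology
open scoped ENNReal

noncomputable section

namespace Literature.Analysis.InverseSpectral

namespace KreinString

/-! ### The constructions -/

/-- **The free half-line `S[0, ∞]`**: infinite length, no mass (the string excluded from Kreĭn's
correspondence, `IsTrivial`). [folklore] -/
def freeHalfLine : KreinString where
  length := ⊤
  length_pos := by simp
  massMeasure := 0
  massMeasure_Iio_zero := rfl
  massMeasure_Iic_lt_top := fun _ _ => by simp
  massMeasure_Ici_eq_zero := fun _ _ => rfl

/-- The free half-line is the trivial string. [folklore] -/
lemma isTrivial_freeHalfLine : freeHalfLine.IsTrivial := ⟨rfl, rfl⟩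

/-- **The empty string `S[0, L]` of finite length `L > 0`** (no mass). [folklore] -/
def empty (L : ℝ) (hL : 0 < L) : KreinString where
  length := ENNReal.ofReal L
  length_pos := by simpa using hL
  massMeasure := 0
  massMeasure_Iio_zero := rfl
  massMeasure_Iic_lt_top := fun _ _ => by simp
  massMeasure_Ici_eq_zero := fun _ _ => rfl

/-- **Adding a point mass `m₀` at the left end**: `dm' = dm + m₀ δ₀`, same length (for `m₀ ≤ 0`
nothing is added, `ENNReal.ofReal m₀ = 0`). [folklore] -/
def addDirac (S : KreinString) (m₀ : ℝ) : KreinString where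
  length := S.length
  length_pos := S.length_pos
  massMeasure := S.massMeasure + (ENNReal.ofReal m₀) • Measure.dirac 0
  massMeasure_Iio_zero := by
    rw [Measure.add_apply, Measure.smul_apply, S.massMeasure_Iio_zero,
      Measure.dirac_apply' _ measurableSet_Iio, indicator_of_notMem (by simp), smul_zero, add_zero]
  massMeasure_Iic_lt_top := fun x hx => by
    rw [Measure.add_apply, Measure.smul_apply]
    refine ENNReal.add_lt_top.2 ⟨S.massMeasure_Iic_lt_top x hx, ?_⟩
    exact ENNReal.mul_lt_top ENNReal.ofReal_lt_top ((measure_mono (subset_univ _)).trans_lt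
      (by simp))
  massMeasure_Ici_eq_zero := fun x hx => by
    have hx0 : 0 < x := by
      by_contra h
      have : ENNReal.ofReal x = 0 := ENNReal.ofReal_eq_zero.2 (not_lt.1 h)
      rw [this] at hx
      exact absurd hx (not_le.2 S.length_pos)
    rw [Measure.add_apply, Measure.smul_apply, S.massMeasure_Ici_eq_zero x hx,
      Measure.dirac_apply' _ measurableSet_Ici, indicator_of_notMem (by simpa using hx0), smul_zero,
      add_zero]

/-- **Prepending a massless segment of length `a ≥ 0`**: length `L + a`, mass shifted right by `a`.
[folklore] -/
def prepend (S : KreinString) (a : ℝ) (ha : 0 ≤ a) : KreinString where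
  length := S.length + ENNReal.ofReal a
  length_pos := lt_of_lt_of_le S.length_pos le_self_add
  massMeasure := S.massMeasure.map (fun u => u + a)
  massMeasure_Iio_zero := by
    rw [Measure.map_apply (measurable_add_const a) measurableSet_Iio]
    refine measure_mono_null (fun u hu => ?_) S.massMeasure_Iio_zero
    simp only [mem_preimage, mem_Iio] at hu ⊢
    linarith
  massMeasure_Iic_lt_top := fun x hx => by
    rw [Measure.map_apply (measurable_add_const a) measurableSet_Iic]
    rcases lt_or_ge x a with hxa | hxa
    · refine lt_of_le_of_lt (measure_mono (fun u hu => ?_)) (S.massMeasure_Iio_zero.le.trans_lt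
        ENNReal.zero_lt_top)
      simp only [mem_preimage, mem_Iic, mem_Iio] at hu ⊢
      linarith
    · have hsplit : ENNReal.ofReal x = ENNReal.ofReal (x - a) + ENNReal.ofReal a := by
        rw [← ENNReal.ofReal_add (by linarith) ha, sub_add_cancel]
      rw [hsplit, ENNReal.add_lt_add_iff_right ENNReal.ofReal_ne_top] at hx
      refine lt_of_le_of_lt (measure_mono (fun u hu => ?_)) (S.massMeasure_Iic_lt_top (x - a) hx)
      simp only [mem_preimage, mem_Iic] at hu ⊢
      linarith
  massMeasure_Ici_eq_zero := fun x hx => by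
    rw [Measure.map_apply (measurable_add_const a) measurableSet_Ici]
    have hxa : a ≤ x := by
      by_contra h
      have h1 : ENNReal.ofReal x ≤ ENNReal.ofReal a :=
        ENNReal.ofReal_le_ofReal (le_of_lt (not_le.1 h))
      have h2 : S.length + ENNReal.ofReal a ≤ ENNReal.ofReal a := hx.trans h1
      have h3 : S.length + ENNReal.ofReal a ≤ 0 + ENNReal.ofReal a := by simpa using h2
      rw [ENNReal.add_le_add_iff_right ENNReal.ofReal_ne_top] at h3
      exact absurd h3 (not_le.2 S.length_pos)
    have hsplit : ENNReal.ofReal x = ENNReal.ofReal (x - a) + ENNReal.ofReal a := by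
      rw [← ENNReal.ofReal_add (by linarith) ha, sub_add_cancel]
    rw [hsplit, ENNReal.add_le_add_iff_right ENNReal.ofReal_ne_top] at hx
    refine measure_mono_null (fun u hu => ?_) (S.massMeasure_Ici_eq_zero (x - a) hx)
    simp only [mem_preimage, mem_Ici] at hu ⊢
    linarith

/-! ### Titchmarsh–Weyl functions of the constructions -/

/-- The empty string of length `L` is not the free half-line. [folklore] -/
lemma not_isTrivial_empty (L : ℝ) (hL : 0 < L) : ¬ (empty L hL).IsTrivial := fun h => by
  have := h.1
  simp [empty] at this

/-- **`q ≡ L` for the empty string `S[0, L]`.** [cite: KacKrein1974, §2] -/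
theorem principalWeylFunction_empty (L : ℝ) (hL : 0 < L) (z : ℂ) :
    (empty L hL).principalWeylFunction z = (L : ℂ) := by
  have h := principalWeylFunction_of_massMeasure_eq_zero (empty L hL) (by simp [empty]) rfl z
  rw [h]
  simp [empty, ENNReal.toReal_ofReal hL.le]

/-- Adding a positive point mass produces a string other than the free half-line. [folklore] -/
lemma not_isTrivial_addDirac (S : KreinString) {m₀ : ℝ} (hm₀ : 0 < m₀) :
    ¬ (S.addDirac m₀).IsTrivial :=
  not_isTrivial_of_add_dirac (S := S) (S' := S.addDirac m₀) rfl hm₀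

/-- **`q ↦ q/(1 - z m₀ q)` under `addDirac`.** [cite: KacKrein1974, §2] -/
theorem principalWeylFunction_addDirac (S : KreinString) {m₀ : ℝ} (hm₀ : 0 < m₀)
    (hS : ¬ S.IsTrivial) {z : ℂ} (hz : z ∈ offNonnegAxis) :
    1 - z * m₀ * S.principalWeylFunction z ≠ 0 ∧
      (S.addDirac m₀).principalWeylFunction z =
        S.principalWeylFunction z / (1 - z * m₀ * S.principalWeylFunction z) :=
  principalWeylFunction_add_dirac (S := S) (S' := S.addDirac m₀) rfl hm₀ rfl hS hz

/-- Prepending a segment to a string other than the free half-line does not produce the free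
half-line. [folklore] -/
lemma not_isTrivial_prepend (S : KreinString) {a : ℝ} (ha : 0 ≤ a) (hS : ¬ S.IsTrivial) :
    ¬ (S.prepend a ha).IsTrivial :=
  not_isTrivial_shift (S := S) (S' := S.prepend a ha) rfl rfl hS

/-- **`q ↦ a + q` under `prepend`.** [cite: KacKrein1974, §2] -/
theorem principalWeylFunction_prepend (S : KreinString) {a : ℝ} (ha : 0 < a) (hS : ¬ S.IsTrivial)
    {z : ℂ} (hz : z ∈ offNonnegAxis) :
    (S.prepend a ha.le).principalWeylFunction z = a + S.principalWeylFunction z :=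
  principalWeylFunction_shift (S := S) (S' := S.prepend a ha.le) rfl rfl ha hS hz

/-- **The free half-line with a point mass `m₀` at `0`**: `q(z) = -1/(m₀ z)` (fundamental system
`φ = 1 - z m₀ x`, `ψ = x`). [cite: KacKrein1974, §2] -/
theorem principalWeylFunction_freeHalfLine_addDirac {m₀ : ℝ} (hm₀ : 0 < m₀) {z : ℂ}
    (hz : z ∈ offNonnegAxis) :
    (freeHalfLine.addDirac m₀).principalWeylFunction z = -(z * m₀)⁻¹ := by
  set S' := freeHalfLine.addDirac m₀ with hS'
  haveI := S'.toEnd_neBot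
  have hz0 : z ≠ 0 := by
    rintro rfl
    simp [mem_offNonnegAxis] at hz
  have hdom : ∀ {x : ℝ}, 0 ≤ x → x ∈ freeHalfLine.dom := fun hx => ⟨hx, by simp [freeHalfLine]⟩
  -- the fundamental system of the free half-line and of `S'`
  have hφ0 : ∀ {x : ℝ}, 0 ≤ x → freeHalfLine.phi z x = 1 := fun hx =>
    freeHalfLine.phi_eq_one_of_massMeasure_Icc_eq_zero z (hdom hx) rfl
  have hψ0 : ∀ {x : ℝ}, 0 ≤ x → freeHalfLine.psi z x = x := fun hx =>
    freeHalfLine.psi_eq_of_massMeasure_Icc_eq_zero z (hdom hx) rfl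
  have hφ' : EqOn (S'.phi z) (fun x => freeHalfLine.phi z x - z * m₀ * freeHalfLine.psi z x)
      S'.dom :=
    (S'.isSolution_phi z).eqOn (isSolution_add_dirac_phi (S := freeHalfLine) (S' := S') rfl hm₀.le
      rfl z)
  have hψ' : EqOn (S'.psi z) (freeHalfLine.psi z) S'.dom :=
    (S'.isSolution_psi z).eqOn (isSolution_add_dirac_psi (S := freeHalfLine) (S' := S') rfl hm₀.le
      rfl z)
  -- the quotient `x/(1 - z m₀ x) = (x⁻¹ - z m₀)⁻¹ → -(z m₀)⁻¹`
  have hend : S'.toEnd = atTop := by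
    unfold toEnd
    rw [if_pos (show S'.length = ⊤ from rfl)]
  have hev : ∀ᶠ x : ℝ in atTop, ((x : ℂ)⁻¹ - z * m₀)⁻¹ = S'.psi z x / S'.phi z x := by
    filter_upwards [eventually_gt_atTop (0 : ℝ)] with x hx
    have hxd : x ∈ S'.dom := ⟨hx.le, by simp [hS', addDirac, freeHalfLine]⟩
    rw [hψ' hxd, hφ' hxd]
    dsimp only
    rw [hφ0 hx.le, hψ0 hx.le]
    have hx0 : (x : ℂ) ≠ 0 := by exact_mod_cast hx.ne'
    field_simp
  have hlim : Tendsto (fun x : ℝ => ((x : ℂ)⁻¹ - z * m₀)⁻¹) atTop (𝓝 ((0 - z * m₀)⁻¹)) := by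
    have h1 : Tendsto (fun x : ℝ => (x : ℂ)⁻¹) atTop (𝓝 0) := by
      have h := (Complex.continuous_ofReal.tendsto 0).comp tendsto_inv_atTop_zero
      refine h.congr (fun x => ?_)
      simp [Function.comp]
    refine ((h1.sub tendsto_const_nhds).inv₀ ?_)
    simpa using mul_ne_zero hz0 (by exact_mod_cast hm₀.ne' : (m₀ : ℂ) ≠ 0)
  rw [zero_sub, inv_neg] at hlim
  have h := (hlim.congr' hev)
  rw [← hend] at h
  exact h.limUnder_eq

/-! ### Stieltjes continued fractions -/

/-- The finite **Stieltjes continued fraction** built on an inner value `f z`: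
`[] ↦ f z`, `(m, l) :: rest ↦ l + r/(1 - z m r)` with `r` the value for `rest` (a point mass `m`
then a massless segment `l` are put in front of the inner string). [cite: KacKrein1974, §2] -/
def stieltjesCF (f : ℂ → ℂ) : List (ℝ × ℝ) → ℂ → ℂ
  | [], z => f z
  | (m, l) :: rest, z =>
      (l : ℂ) + stieltjesCF f rest z / (1 - z * m * stieltjesCF f rest z)

/-- Unfolding of `stieltjesCF` on the empty list. [folklore] -/
@[simp] lemma stieltjesCF_nil (f : ℂ → ℂ) (z : ℂ) : stieltjesCF f [] z = f z := rfl

/-- Unfolding of `stieltjesCF` on a cons. [folklore] -/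
lemma stieltjesCF_cons (f : ℂ → ℂ) (m l : ℝ) (rest : List (ℝ × ℝ)) (z : ℂ) :
    stieltjesCF f ((m, l) :: rest) z =
      (l : ℂ) + stieltjesCF f rest z / (1 - z * m * stieltjesCF f rest z) := rfl

/-- **Realisation of Stieltjes continued fractions by strings.** If the inner function `f` is the
principal Titchmarsh–Weyl function of some string other than the free half-line, then so is every
continued fraction `stieltjesCF f data` with point masses `m > 0` and segment lengths `l ≥ 0`.
[cite: KacKrein1974, §2] -/
theorem exists_string_stieltjesCF {f : ℂ → ℂ}
    (hf : ∃ S₀ : KreinString, ¬ S₀.IsTrivial ∧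
      ∀ z ∈ offNonnegAxis, S₀.principalWeylFunction z = f z)
    (data : List (ℝ × ℝ)) (hdata : ∀ p ∈ data, 0 < p.1 ∧ 0 ≤ p.2) :
    ∃ S : KreinString, ¬ S.IsTrivial ∧
      ∀ z ∈ offNonnegAxis, S.principalWeylFunction z = stieltjesCF f data z := by
  induction data with
  | nil => simpa using hf
  | cons p rest ih =>
    obtain ⟨m, l⟩ := p
    obtain ⟨hm, hl⟩ : 0 < m ∧ 0 ≤ l := hdata (m, l) List.mem_cons_self
    obtain ⟨S, hS, hq⟩ := ih (fun p hp => hdata p (List.mem_cons_of_mem _ hp))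
    have hadd : ∀ z ∈ offNonnegAxis, (S.addDirac m).principalWeylFunction z =
        stieltjesCF f rest z / (1 - z * m * stieltjesCF f rest z) := fun z hz => by
      rw [(S.principalWeylFunction_addDirac hm hS hz).2, hq z hz]
    rcases eq_or_lt_of_le hl with hl0 | hl0
    · refine ⟨S.addDirac m, S.not_isTrivial_addDirac hm, fun z hz => ?_⟩
      rw [stieltjesCF_cons, hadd z hz, ← hl0, Complex.ofReal_zero, zero_add]
    · refine ⟨(S.addDirac m).prepend l hl0.le,
        (S.addDirac m).not_isTrivial_prepend hl0.le (S.not_isTrivial_addDirac hm), fun z hz => ?_⟩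
      rw [stieltjesCF_cons, (S.addDirac m).principalWeylFunction_prepend hl0
        (S.not_isTrivial_addDirac hm) hz, hadd z hz]

/-- **Stieltjes strings of finite length**: for `L > 0` and data `(mₖ > 0, lₖ ≥ 0)` there is a
string (the empty string `S[0, L]` with the point masses and segments put in front) whose principal
Titchmarsh–Weyl function is the continued fraction `stieltjesCF L data`.
[cite: KacKrein1974, §2] -/
theorem exists_string_stieltjesCF_finite (L : ℝ) (hL : 0 < L) (data : List (ℝ × ℝ))
    (hdata : ∀ p ∈ data, 0 < p.1 ∧ 0 ≤ p.2) :
    ∃ S : KreinString, ¬ S.IsTrivial ∧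
      ∀ z ∈ offNonnegAxis, S.principalWeylFunction z = stieltjesCF (fun _ => (L : ℂ)) data z :=
  exists_string_stieltjesCF ⟨empty L hL, not_isTrivial_empty L hL,
    fun z _ => principalWeylFunction_empty L hL z⟩ data hdata

/-- **Stieltjes strings of infinite length**: for `m₀ > 0` and data `(mₖ > 0, lₖ ≥ 0)` there is a
string (the free half-line with the mass `m₀` at its left end, then the point masses and segments
put in front) whose principal Titchmarsh–Weyl function is `stieltjesCF (-1/(m₀ z)) data`.
[cite: KacKrein1974, §2] -/
theorem exists_string_stieltjesCF_infinite {m₀ : ℝ} (hm₀ : 0 < m₀) (data : List (ℝ × ℝ))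
    (hdata : ∀ p ∈ data, 0 < p.1 ∧ 0 ≤ p.2) :
    ∃ S : KreinString, ¬ S.IsTrivial ∧
      ∀ z ∈ offNonnegAxis, S.principalWeylFunction z = stieltjesCF (fun z => -(z * m₀)⁻¹) data z :=
  exists_string_stieltjesCF ⟨freeHalfLine.addDirac m₀, freeHalfLine.not_isTrivial_addDirac hm₀,
    fun _ hz => principalWeylFunction_freeHalfLine_addDirac hm₀ hz⟩ data hdata

/-- **One-atom Stieltjes functions are Titchmarsh–Weyl functions**: for `b ≥ 0`, `c > 0`, `λ ≥ 0`
there is a string with `q_S(z) = b + c/(λ - z)` off `[0, ∞)` (a segment of length `b`, one point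
mass `1/c`, then a segment of length `c/λ`, read as the free half-line when `λ = 0`).
[cite: KacKrein1974, §2] -/
theorem exists_string_one_atom {b c lam : ℝ} (hb : 0 ≤ b) (hc : 0 < c) (hlam : 0 ≤ lam) :
    ∃ S : KreinString, ¬ S.IsTrivial ∧
      ∀ z ∈ offNonnegAxis, S.principalWeylFunction z = b + c / (lam - z) := by
  have hm : 0 < 1 / c := by positivity
  rcases eq_or_lt_of_le hlam with hlam0 | hlam0
  · -- `λ = 0`: the free half-line with the mass `1/c` at `0`, behind a segment of length `b`
    subst hlam0
    have hbase : ∀ z ∈ offNonnegAxis,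
        (freeHalfLine.addDirac (1 / c)).principalWeylFunction z = c / (0 - z) := fun z hz => by
      rw [principalWeylFunction_freeHalfLine_addDirac hm hz]
      have hz0 : z ≠ 0 := by rintro rfl; simp [mem_offNonnegAxis] at hz
      have hc0 : (c : ℂ) ≠ 0 := by exact_mod_cast hc.ne'
      push_cast
      field_simp
      ring
    rcases eq_or_lt_of_le hb with hb0 | hb0
    · subst hb0
      refine ⟨freeHalfLine.addDirac (1 / c), freeHalfLine.not_isTrivial_addDirac hm, fun z hz => ?_⟩
      rw [hbase z hz]
      push_cast
      ring
    · refine ⟨(freeHalfLine.addDirac (1 / c)).prepend b hb0.le,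
        (freeHalfLine.addDirac (1 / c)).not_isTrivial_prepend hb0.le
          (freeHalfLine.not_isTrivial_addDirac hm), fun z hz => ?_⟩
      rw [(freeHalfLine.addDirac (1 / c)).principalWeylFunction_prepend hb0
        (freeHalfLine.not_isTrivial_addDirac hm) hz, hbase z hz]
      push_cast
      ring
  · -- `λ > 0`: the continued fraction `b + L/(1 - z L/c)` with `L = c/λ`
    have hL : 0 < c / lam := by positivity
    obtain ⟨S, hS, hq⟩ := exists_string_stieltjesCF_finite (c / lam) hL [(1 / c, b)]
      (fun p hp => by
        simp only [List.mem_singleton] at hp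
        subst hp
        exact ⟨hm, hb⟩)
    refine ⟨S, hS, fun z hz => ?_⟩
    rw [hq z hz, stieltjesCF_cons, stieltjesCF_nil]
    have hc0 : (c : ℂ) ≠ 0 := by exact_mod_cast hc.ne'
    have hl0 : (lam : ℂ) ≠ 0 := by exact_mod_cast hlam0.ne'
    have hlz : (lam : ℂ) - z ≠ 0 := fun h0 => by
      have hzl : z = (lam : ℂ) := (sub_eq_zero.1 h0).symm
      rcases hz with him | hre
      · exact him (by rw [hzl, Complex.ofReal_im])
      · rw [hzl, Complex.ofReal_re] at hre; linarith
    congr 1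
    push_cast
    field_simp

end KreinString

end Literature.Analysis.InverseSpectral

end
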